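import Summits.Langlands.Langlands.Theses.QuadraticWindow
import Summits.Langlands.Langlands.Theses.LiftDescend
import Summits.Langlands.Langlands.Theorems.QuadraticWindowBeyondTheWindow
import Summits.Langlands.Langlands.Theorems.QuadraticWindowBeyondTheWindowSummitImpliesWindow
import Literature.NumberTheory.Automorphic.ScholzeTorsionGalois
import Literature.Barriers.Langlands.ShtukaConstantFieldBarrier
import Literature.Barriers.Langlands.SolvableImageBarrier

/-!
# Strategy census companion — crux `QuadraticWindow.BeyondTheWindow` (stmt-Langlands-3202)

Crux-strategist seat `planner-cstrat-stmt-Langlands-3202-0` (2026-08-16).  This file kernel-checks the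
TYPED objects quoted in `Cruxes/BeyondTheWindow/STRATEGY-CENSUS.md`: the law of lines of the frame
item, the strengthening law, the two best typed splits (by direction / by sector) with their glue
and their "remaining piece" theorems, the typed strengthening `TorsionReciprocityAll`, and the
negation shape.  Nothing here proves `QuadraticWindowA`, `BeyondTheWindow` or `Langlands`: every
declaration with a route decl or the summit in its conclusion carries it as a hypothesis too.

The crux: `BeyondTheWindow := QuadraticWindowA → Langlands` (route file, rank 9, the declared
RESIDUAL of the sector route QuadraticWindow).  Landed certificates used (never re-proved):
`Theorems.beyondTheWindow_iff_not_or` (p83390), `Theorems.QuadraticWindowResidual.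
langlands_iff_quadraticWindowA_and_beyondTheWindow`, `….exists_galoisRep_satake_of_langlands`
(p85108).
-/

set_option linter.unusedVariables false
set_option linter.dupNamespace false -- `Summit.Langlands.Langlands.…` is the mandated namespace (D-0017)

noncomputable section

namespace Summit.Langlands.Langlands.Cruxes.BeyondTheWindow.StrategyCensus

open Summit.Langlands
open Summit.Langlands.Langlands.Theses.QuadraticWindow
open Summit.Langlands.Langlands.Theorems.QuadraticWindowResidual
open Literature.NumberTheory.Automorphic Literature.NumberTheory.GaloisRepresentations
open NumberField IsDedekindDomain Filter Polynomial

/-! ## §0  The law of lines of a frame item -/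

/-- **Law of lines.**  A stub set `T` concludes the crux iff `T` together with the window theorem
proves the summit.  Every skeleton `stub₁ → … → stub_k → BeyondTheWindow` is therefore a proof of
`Langlands` from `⋀ stubᵢ ∧ QuadraticWindowA`. [folklore] -/
theorem law_of_lines (T : Prop) :
    (T → BeyondTheWindow) ↔ (T ∧ QuadraticWindowA → _root_.Langlands) :=
  ⟨fun h ⟨hT, hX⟩ => h hT hX, fun h hT hX => h ⟨hT, hX⟩⟩

/-- **Given the window, the crux IS the summit** (p83390 `beyondTheWindow_iff_langlands`,
restated through the landed `↔`). [folklore] -/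
theorem crux_iff_langlands_of_window (hX : QuadraticWindowA) : BeyondTheWindow ↔ _root_.Langlands :=
  ⟨fun h => h hX, fun h _ => h⟩

/-- **Strengthening law.**  Any `S⁺` that implies the crux and is implied by the summit (every
natural strengthening of a residual) satisfies `S⁺ ∧ X ↔ Langlands`: modulo the summit-implied
window, an admissible strengthening of the crux is the summit itself. [folklore] -/
theorem strengthening_law (S : Prop) (hS : S → BeyondTheWindow) (hL : _root_.Langlands → S) :
    (S ∧ QuadraticWindowA) ↔ _root_.Langlands :=
  ⟨fun ⟨hs, hX⟩ => hS hs hX, fun h => ⟨hL h, (langlands_iff_quadraticWindowA_and_beyondTheWindow.mp h).1⟩⟩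

/-- **Frames are antitone in the sector**: enlarging the sector weakens the frame, never below
"summit modulo the larger sector". [folklore] -/
theorem frame_antitone {S₁ S₂ : Prop} (h : S₂ → S₁) :
    (S₁ → _root_.Langlands) → (S₂ → _root_.Langlands) := fun f s => f (h s)

/-- All the sub-problem's sector frames at once are one frame on the disjunction of the sectors
(so a shared pair of summit-level items would subsume every per-route frame). [folklore] -/
theorem frames_conj_iff (S₁ S₂ : Prop) :
    ((S₁ → _root_.Langlands) ∧ (S₂ → _root_.Langlands)) ↔ (S₁ ∨ S₂ → _root_.Langlands) :=
  ⟨fun h s => s.elim h.1 h.2, fun h => ⟨fun s => h (Or.inl s), fun s => h (Or.inr s)⟩⟩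

/-! ## §D1  Decomposition by DIRECTION (the LiftDescend seam), typed, glue kernel-checked -/

/-- Direction (A) over every number field (the conclusion of `LiftDescend.AscentAutToGal`; routes
LiftDescend / CMFern / BaseFieldAscent / SmithKummerSeed reach it by field class).
[cite: BuzzardGeeLMS2014, Conj. 3.2.1 and Conj. 3.2.2] -/
def AutToGalAll : Prop :=
  ∀ (F : Type) [Field F] [NumberField F], ∃ R : ReciprocityData F, ∀ n : ℕ, 0 < n →
    ∀ hcpt : isCompact_glFiniteIntegralLevel n F, AutomorphicToGalois n R hcpt

/-- Weak direction (B) over every number field, GIVEN (A) for the same reciprocity data (the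
second hypothesis of `LiftDescend.WeakToStrongGalToAut`, universally; LiftDescend reaches it as
PotentialAutomorphy + DescentOfAutomorphy). [cite: FontaineMazurGeometric1995, Conj. 1] -/
def WeakGalToAutAll : Prop :=
  ∀ (F : Type) [Field F] [NumberField F] (R : ReciprocityData F),
    (∀ n : ℕ, 0 < n → ∀ hcpt : isCompact_glFiniteIntegralLevel n F, AutomorphicToGalois n R hcpt) →
    ∀ (n : ℕ), 0 < n → ∀ (ℓ : ℕ) [Fact ℓ.Prime] (ι : PadicAlgCl ℓ ≃+* ℂ)
      (ρ : FramedGaloisRep F (PadicAlgCl ℓ) n), ρ.toGaloisRep.IsIrreducible → IsGeometricFramed R ρ →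
      ∀ hcpt : isCompact_glFiniteIntegralLevel n F, ∃ π : CuspidalAutomorphicRepData n F hcpt,
        π.1.IsLAlgebraic ∧ ∀ᶠ v : HeightOneSpectrum (𝓞 F) in cofinite, SatakeFrobCompatibleAt ι π.1 ρ v

/-- **D1 glue (sorry-free):** (A) everywhere + weak (B) everywhere + LiftDescend's weak-to-strong
transport item ⟹ the crux — with the window theorem UNUSED (it is an instance of `AutToGalAll`).
This is a decomposition of the SUMMIT, i.e. route LiftDescend's thesis, not of this step. [folklore] -/
theorem beyond_of_directionSplit (hA : AutToGalAll) (hB : WeakGalToAutAll)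
    (hT : Summit.Langlands.Langlands.Theses.LiftDescend.WeakToStrongGalToAut) : BeyondTheWindow := by
  intro _hX F _ _
  obtain ⟨R, hR⟩ := hA F
  exact ⟨R, fun n hn hcpt => ⟨hR n hn hcpt, hT F R hR (hB F R hR) n hn hcpt⟩⟩

/-- The pinned `p`-adic Hodge datum makes geometricity independent of the reciprocity data
(statement audit AMBER-4, D-0018 L2): `IsGeometricFramed R ρ` does not depend on `R`. [folklore] -/
theorem isGeometricFramed_irrel {F : Type} [Field F] [NumberField F] {ℓ : ℕ} [Fact ℓ.Prime] {n : ℕ}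
    (R R' : ReciprocityData F) (ρ : FramedGaloisRep F (PadicAlgCl ℓ) n) :
    IsGeometricFramed R ρ ↔ IsGeometricFramed R' ρ := Iff.rfl

/-- Both D1 pieces are honest halves of the summit: the summit implies `AutToGalAll` … [folklore] -/
theorem autToGalAll_of_langlands (hL : _root_.Langlands) : AutToGalAll := by
  intro F _ _
  obtain ⟨R, hR⟩ := hL F
  exact ⟨R, fun n hn hcpt => (hR n hn hcpt).1⟩

/-- … and `WeakGalToAutAll` (for ANY reciprocity data, because geometricity is pinned and the
Satake clause of `Corresponds` does not mention `R`). [folklore] -/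
theorem weakGalToAutAll_of_langlands (hL : _root_.Langlands) : WeakGalToAutAll := by
  intro F _ _ R _hA n hn ℓ _ ι ρ hirr hgeo hcpt
  obtain ⟨R₀, hR₀⟩ := hL F
  obtain ⟨π, hLalg, hcorr⟩ :=
    (hR₀ n hn hcpt).2 ℓ ι ρ hirr ((isGeometricFramed_irrel R R₀ ρ).mp hgeo)
  exact ⟨π, hLalg, hcorr.1⟩

/-- **Remaining piece of D1.**  Granted (A) everywhere and the transport item, the weak-(B) piece is
equivalent to the crux given the window — i.e. it remains "the summit's other half"; symmetrically
for the (A) piece.  Neither child is smaller than half the summit. [folklore] -/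
theorem weakB_iff_crux_of_A (hX : QuadraticWindowA) (hA : AutToGalAll)
    (hT : Summit.Langlands.Langlands.Theses.LiftDescend.WeakToStrongGalToAut) :
    WeakGalToAutAll ↔ BeyondTheWindow :=
  ⟨fun hB => beyond_of_directionSplit hA hB hT, fun h => weakGalToAutAll_of_langlands (h hX)⟩

/-! ## §D2  Decomposition by SECTOR (the route's own engine, second and third windows), typed -/

/-- **T1 — the essentially-self-dual annex** (second root of the polarizability equation; ideator
k1 card `self-dual-window-sign-unpackaging`, ideator k2 §4 T1): `QuadraticWindowA` with the
τ-POLARIZATION clause replaced by ESSENTIAL SELF-DUALITY with base-changed similitude,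
`π^∨ ≅ π ⊗ (χ‖·‖^{-k})∘N_{F/F₀}∘det` almost everywhere on Satake parameters (Artin avatar `e` of
`χ`); all other clauses verbatim.  Same host engine (AI is then polarized over `F₀`), new
extraction lemma on sign twists. `n = 2`, `k = 0`, `χ = 1` is BCGP Thm 2.7.
[cite: BoxerEtAl2021, Thm. 2.7] -/
def SelfDualWindowA : Prop :=
  ∀ (F₀ F : Type) [Field F₀] [NumberField F₀] [Field F] [NumberField F] [Algebra F₀ F] (τ : F ≃ₐ[F₀] F), NumberField.IsTotallyReal F₀ → Module.finrank F₀ F = 2 → τ ≠ 1 → ∀ (n : ℕ) (hcpt : Literature.NumberTheory.Automorphic.isCompact_glFiniteIntegralLevel n F) (π : Literature.NumberTheory.Automorphic.CuspidalAutomorphicRepData n F hcpt) (e : Literature.NumberTheory.GaloisRepresentations.FramedGaloisRep F₀ ℂ 1) (k : ℤ), π.1.IsRegularAlgebraic → (∀ᶠ w in Filter.cofinite, ∀ (α : Multiset ℂ) (c : ℂ), π.1.HasSatakeParamAt w α → e.HasFrobCharpolyAt (w.under (NumberField.RingOfIntegers F₀)) (Polynomial.X - Polynomial.C c) → α.map (fun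 a ↦ a⁻¹) = α.map (fun a ↦ a * (c * ((w.under (NumberField.RingOfIntegers F₀)).residueCard : ℂ) ^ k) ^ w.asIdeal.inertiaDeg (NumberField.RingOfIntegers F₀))) → ((e.restrictField F).IsOdd ∨ ∀ (φ : F →+* ℝ) (c : Field.absoluteGaloisGroup F), Literature.NumberTheory.GaloisRepresentations.IsComplexConjugation φ c → Matrix.GeneralLinearGroup.det ((e.restrictField F) c) = 1) → (Odd n → (e.restrictField F).IsOdd) → (∃ᶠ w in Filter.cofinite, ∃ α β : Multiset ℂ, π.1.HasSatakeParamAt w α ∧ π.1.HasSatakeParamAt (τ • w) β ∧ β ≠ α) → ∀ (ℓ : ℕ) [Fact ℓ.Prime] (ι : PadicAlgCl ℓ ≃+* ℂ), ¬ ((ℓ : ℤ) ∣ NumberField.discr F) → (∀ w : IsDedekindDomain.HeightOneSpectrum (NumberField.RingOfIntegers F), ((ℓ : ℕ) : NumberField.RingOfIntegers F) ∈ w.asIdeal → π.1.IsUnramifiedAt w) → ∃ ρ : Literature.NumberTheory.GaloisRepresentations.FramedGaloisRep F (PadicAlgCl ℓ) n, ρ.toGaloisRep.IsSemisimple ∧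 ∀ᶠ w in Filter.cofinite, ∀ α : Multiset ℂ, π.1.HasSatakeParamAt w α → ρ.IsUnramifiedAt w ∧ ρ.HasFrobCharpolyAt w (Literature.NumberTheory.Automorphic.arithFrobPolyOfSatake ι w.residueCard n α)

/-- **T2 — the CM-compositum annex** (ideator k2 §4 T2; reach invariant `e = 2`, `d = 4`): `F₀`
totally real, `F₁/F₀` CM quadratic, `K/F₁` quadratic (so `K/F₀` biquadratic with
`F₀`-automorphisms `σ = Gal(K/F₁)` and `c ≠ 1, σ`), `π` cuspidal regular algebraic on `GL_n/K`,
POLARIZED ALONG `K/K^c`: `Sat(π, c • w) = Sat(π, w)⁻¹ · (c_v q_v^k)^{f(w|v)}` a.e. (Artin avatar `e`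
over `F₀`, exponent `k`), not `σ`-invariant; `ℓ` unramified in `K`, `π` unramified above `ℓ`.
Conclusion: a semisimple `ρ : Γ_K → GL_n(ℚ̄_ℓ)` with cofinite Satake–Frobenius matching.  Engine:
`AI_{K/F₁}(π)` is cuspidal, conjugate-self-dual up to twist over the CM field `F₁`, every exponent
doubled ⇒ Mok descent to `U_{F₁/F₀}(2n)` in non-degenerate LDS weight, NO split real places, NO
parity normalisation.  (When `K` happens to be CM the statement is inside lang.S27.)
[cite: Mok2015, Thm. 2.5.4(a)] [cite: GoldringKoskivirta2019, Thm. 3.5.5] -/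
def CompositumWindowA : Prop :=
  ∀ (F₀ F₁ K : Type) [Field F₀] [NumberField F₀] [Field F₁] [NumberField F₁] [Field K] [NumberField K] [Algebra F₀ F₁] [Algebra F₁ K] [Algebra F₀ K] [IsScalarTower F₀ F₁ K] (σ c : K ≃ₐ[F₀] K), NumberField.IsTotallyReal F₀ → NumberField.IsCMField F₁ → Module.finrank F₀ F₁ = 2 → Module.finrank F₁ K = 2 → σ ≠ 1 → (∀ x : F₁, σ (algebraMap F₁ K x) = algebraMap F₁ K x) → c ≠ 1 → c ≠ σ → ∀ (n : ℕ) (hcpt : Literature.NumberTheory.Automorphic.isCompact_glFiniteIntegralLevel n K) (π : Literature.NumberTheory.Automorphic.CuspidalAutomorphicRepData n K hcpt) (e : Literature.NumberTheory.GaloisRepresentations.FramedGaloisRep F₀ ℂ 1) (k : ℤ), π.1.IsRegularAlgebraic → (∀ᶠ w in Filter.cofinite, ∀ (α β : Multiset ℂ) (c₀ : ℂ), π.1.HasSatakeParamAt w α → π.1.HasSatakeParamAt (c • w) β → e.HasFrobCharpolyAt (w.under (NumberField.RingOfIntegers F₀)) (Polynomial.X - Polynomial.C c₀) → β = α.map (fun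 a ↦ a⁻¹ * (c₀ * ((w.under (NumberField.RingOfIntegers F₀)).residueCard : ℂ) ^ k) ^ w.asIdeal.inertiaDeg (NumberField.RingOfIntegers F₀))) → (∃ᶠ w in Filter.cofinite, ∃ α β : Multiset ℂ, π.1.HasSatakeParamAt w α ∧ π.1.HasSatakeParamAt (σ • w) β ∧ β ≠ α) → ∀ (ℓ : ℕ) [Fact ℓ.Prime] (ι : PadicAlgCl ℓ ≃+* ℂ), ¬ ((ℓ : ℤ) ∣ NumberField.discr K) → (∀ w : IsDedekindDomain.HeightOneSpectrum (NumberField.RingOfIntegers K), ((ℓ : ℕ) : NumberField.RingOfIntegers K) ∈ w.asIdeal → π.1.IsUnramifiedAt w) → ∃ ρ : Literature.NumberTheory.GaloisRepresentations.FramedGaloisRep K (PadicAlgCl ℓ) n, ρ.toGaloisRep.IsSemisimple ∧ ∀ᶠ w in Filter.cofinite, ∀ α : Multiset ℂ, π.1.HasSatakeParamAt w α → ρ.IsUnramifiedAt w ∧ ρ.HasFrobCharpolyAt w (Literature.NumberTheory.Automorphic.arithFrobPolyOfSatake ι w.residueCard n α)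

/-- The new declared residual of the sector split: the summit outside all three windows. -/
def BeyondAllWindows : Prop :=
  QuadraticWindowA → SelfDualWindowA → CompositumWindowA → _root_.Langlands

/-- **D2 glue (sorry-free):** `BeyondTheWindow ⟸ SelfDualWindowA ∧ CompositumWindowA ∧
BeyondAllWindows` — pure logic. [folklore] -/
theorem beyond_of_sectorSplit (hT1 : SelfDualWindowA) (hT2 : CompositumWindowA)
    (hRest : BeyondAllWindows) : BeyondTheWindow :=
  fun hX => hRest hX hT1 hT2

/-- **T1 is an honest instance of the summit** (exactly as X is, p85108): under full reciprocity
none of its special hypotheses is needed; `n = 0` is excluded by the non-`τ`-invariance clause.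
[cite: BuzzardGeeLMS2014, Conj. 3.2.1 and §5.3] -/
theorem selfDualWindowA_of_langlands (hL : _root_.Langlands) : SelfDualWindowA := by
  intro F₀ F _ _ _ _ _ τ _ _ _ n hcpt π _ _ hreg _ _ _ hnti ℓ _ ι _ _
  rcases Nat.eq_zero_or_pos n with rfl | hn
  · exfalso
    obtain ⟨w, α, β, hα, hβ, hne⟩ := hnti.exists
    exact hne ((Multiset.card_eq_zero.mp hβ.card_eq).trans
      (Multiset.card_eq_zero.mp hα.card_eq).symm)
  · obtain ⟨ρ, hirr, hρ⟩ := exists_galoisRep_satake_of_langlands hL hn hcpt π hreg ℓ ι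
    exact ⟨ρ, isSemisimple_of_isIrreducible ρ hirr, hρ⟩

/-- **T2 is an honest instance of the summit.** [cite: BuzzardGeeLMS2014, Conj. 3.2.1 and §5.3] -/
theorem compositumWindowA_of_langlands (hL : _root_.Langlands) : CompositumWindowA := by
  intro F₀ F₁ K _ _ _ _ _ _ _ _ _ _ σ c _ _ _ _ _ _ _ _ n hcpt π _ _ hreg _ hnti ℓ _ ι _ _
  rcases Nat.eq_zero_or_pos n with rfl | hn
  · exfalso
    obtain ⟨w, α, β, hα, hβ, hne⟩ := hnti.exists
    exact hne ((Multiset.card_eq_zero.mp hβ.card_eq).trans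
      (Multiset.card_eq_zero.mp hα.card_eq).symm)
  · obtain ⟨ρ, hirr, hρ⟩ := exists_galoisRep_satake_of_langlands hL hn hcpt π hreg ℓ ι
    exact ⟨ρ, isSemisimple_of_isIrreducible ρ hirr, hρ⟩

/-- The summit implies the new residual (it implies everything of this shape). [folklore] -/
theorem beyondAllWindows_of_langlands (hL : _root_.Langlands) : BeyondAllWindows :=
  fun _ _ _ => hL

/-- **Remaining piece of D2 = the whole crux.**  Given the two annex theorems, the new residual is
EQUIVALENT to the old one (frames are antitone and the annexes are summit-implied): carving more
windows never shrinks the frame below "summit modulo the windows". [folklore] -/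
theorem beyondAllWindows_iff_crux (hT1 : SelfDualWindowA) (hT2 : CompositumWindowA) :
    BeyondAllWindows ↔ BeyondTheWindow :=
  ⟨fun h => beyond_of_sectorSplit hT1 hT2 h, fun h hX _ _ => h hX⟩

/-- … and given the window theorem as well, it is the summit verbatim. [folklore] -/
theorem beyondAllWindows_iff_langlands (hX : QuadraticWindowA) (hT1 : SelfDualWindowA)
    (hT2 : CompositumWindowA) : BeyondAllWindows ↔ _root_.Langlands :=
  ⟨fun h => h hX hT1 hT2, fun h _ _ _ => h⟩

/-! ## §S  A typed strengthening: torsion reciprocity over EVERY number field -/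

/-- **S⁺_tors — torsion (mod `p`) reciprocity for `GL_n` over every number field** (Ash 1992 /
Calegari–Geraghty Conj. B, mod-`p` Satake part): Scholze's Cor. V.4.3 with the hypothesis
"`F` totally real or CM" and the two `F⁺`-relative side conditions DELETED — every mod-`p` Hecke
eigensystem occurring in `H^i(X_K, 𝔽̄_p)` for `GL_n/F`, ANY number field `F`, has a semisimple
Galois representation unramified outside `S` with the Scholze–Hecke characteristic polynomial.
The rigidity it adds (Calegari–Geraghty patching in positive defect `l₀ > 0`) is real; its only
engine (boundary of Hodge-type Shimura varieties) exists for `F` totally real or CM only.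
[cite: Scholze2015, Conj. I.2 and Cor. V.4.3] [cite: CalegariGeraghty2018, Conj. B] -/
def TorsionReciprocityAll : Prop :=
  ∀ (F : Type) [Field F] [NumberField F] (n : ℕ), 1 ≤ n → ∀ (p : ℕ) [Fact p.Prime]
    (S : Finset (HeightOneSpectrum (𝓞 F))),
    (∀ v : HeightOneSpectrum (𝓞 F), ((p : ℕ) : 𝓞 F) ∈ v.asIdeal → v ∈ S) →
  ∀ (K : Subgroup (GL (Fin n) (FiniteAdeleRing (𝓞 F) F))),
    IsOpen (K : Set (GL (Fin n) (FiniteAdeleRing (𝓞 F) F))) →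
    K ≤ glFiniteIntegralLevel n F →
    (∀ g ∈ glFiniteIntegralLevel n F,
      (∀ v ∈ S, ∀ i j : Fin n,
        ((g : Matrix (Fin n) (Fin n) (FiniteAdeleRing (𝓞 F) F)) i j) v =
          (1 : Matrix (Fin n) (Fin n) (v.adicCompletion F)) i j) → g ∈ K) →
  ∀ (ϖ : ∀ v : HeightOneSpectrum (𝓞 F), (v.adicCompletion F)ˣ),
    (∀ v, Valued.v ((ϖ v : (v.adicCompletion F)ˣ) : v.adicCompletion F) = WithZero.exp (-1 : ℤ)) →
  ∀ (k : Type) [Field k] [CharP k p] [IsAlgClosed k] [TopologicalSpace k] [DiscreteTopology k],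
    (∀ x : k, ∃ m : ℕ, 0 < m ∧ x ^ p ^ m = x) →
  ∀ (i : ℕ) (a : HeightOneSpectrum (𝓞 F) → ℕ → k),
    HeckeEigenvaluesOccurGL n F k S K ϖ i a →
    ∃ ρ : FramedGaloisRep F k n,
      ρ.toGaloisRep.IsSemisimple ∧
      (∀ v : HeightOneSpectrum (𝓞 F), v ∉ S → ρ.IsUnramifiedAt v) ∧
      ∀ v : HeightOneSpectrum (𝓞 F), v ∉ S → ∀ 𝔓 ∈ v.primesAbove, ∀ σ : Field.absoluteGaloisGroup F,
        IsArithFrobAt (𝓞 F) σ 𝔓 →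
          ((ρ σ⁻¹ : GL (Fin n) k) : Matrix (Fin n) (Fin n) k).charpolyRev =
            scholzeHeckePolynomial n v.residueCard (a v)

/-- Sanity: the strengthening specialises to the sibling's THEOREM (Scholze 2015 Cor. V.4.3 as the
tree's named fact) by forgetting the CM hypothesis and the two side conditions. [cite: Scholze2015, Cor. V.4.3] -/
theorem scholze2015_of_torsionReciprocityAll (h : TorsionReciprocityAll) :
    Scholze2015_galoisRep_of_modPEigensystem := by
  intro F _ _ _ n hn p _ S hSp _ _ K hKo hKle hKS ϖ hϖ k _ _ _ _ _ hk i a hocc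
  exact h F n hn p S hSp K hKo hKle hKS ϖ hϖ k hk i a hocc

/-! ## §N  Negation shape, and what every proof of the crux must use -/

/-- **Negation shape** (p83390 `beyondTheWindow_iff_not_or`, contraposed): a refutation of the crux
is a proof of the window theorem TOGETHER WITH a disproof of the summit. [folklore] -/
theorem not_crux_iff : ¬ BeyondTheWindow ↔ (QuadraticWindowA ∧ ¬ _root_.Langlands) :=
  ⟨fun h => ⟨Classical.byContradiction fun hX => h (fun x => absurd x hX), fun hL => h (fun _ => hL)⟩,
    fun hh hB => hh.2 (hB hh.1)⟩

/-- (The same table through the landed certificate p83390.) [folklore] -/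
example : BeyondTheWindow ↔ (¬ QuadraticWindowA ∨ _root_.Langlands) :=
  Summit.Langlands.Langlands.Theorems.beyondTheWindow_iff_not_or

/-- Any negative lemma `H → ¬crux` is a conditional disproof of the summit: there is no
`BeyondTheWindow_false_without_H` with `H` below summit size. [folklore] -/
theorem negativeLemma_transfers (H : Prop) (h : H → ¬ BeyondTheWindow) : H → ¬ _root_.Langlands :=
  fun hH hL => h hH (fun _ => hL)

/-- **What every proof must use (Disproof-substitute).**  The summit — hence the crux, given the
window — produces local Langlands data at every finite place of every number field: a line on this
crux must carry `LocalLanglandsDatum.nonempty` (Harris–Taylor/Henniart, a named fact of the tree)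
as a stub or construct `rec_v`.  No junk reciprocity datum exists to exploit (prover gen-1, E2).
[cite: HarrisTaylorAMS2001, Thm. A] -/
theorem llc_of_langlands (hL : _root_.Langlands) (F : Type) [Field F] [NumberField F]
    (v : HeightOneSpectrum (𝓞 F)) : Nonempty (LocalLanglandsDatum (v.adicCompletion F)) := by
  obtain ⟨R, -⟩ := hL F
  exact ⟨R.llc v⟩

/-- The same obligation for the crux itself. [folklore] -/
theorem llc_of_crux (h : BeyondTheWindow) (hX : QuadraticWindowA) (F : Type) [Field F]
    [NumberField F] (v : HeightOneSpectrum (𝓞 F)) :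
    Nonempty (LocalLanglandsDatum (v.adicCompletion F)) :=
  llc_of_langlands (h hX) F v

/-- **The floor of the complement** is catalogued, not conjectural: the solvable-image barrier
(Langlands–Tunnell stops at `A₅`) and the shtuka barrier (no `X ×_{𝔽_q} X` over a number field)
are theorems of the tree; both bound the Transfer heading of the census. -/
example : Literature.Barriers.Langlands.SolvableImageBarrier ∧
    Literature.Barriers.Langlands.ShtukaConstantFieldBarrierNarrow :=
  ⟨Literature.Barriers.Langlands.SolvableImageBarrier_holds,
    Literature.Barriers.Langlands.ShtukaConstantFieldBarrierNarrow_holds⟩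

end Summit.Langlands.Langlands.Cruxes.BeyondTheWindow.StrategyCensus

end
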